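import Summits.QuantumFields.BalabanUV.T4Continuum.Support.BlockAverageVaryHolo
import HarnessLib

/-!
# T⁴ programme, node NE3, row S6-Y7 (P3 leaf L7 «SLOP», part (a), ONE STEP) — file 2: THE DISC OF CONTROL OF THE
# RELATIVE CHART COORDINATE `σ ↦ log(V̄(c)⁻¹ · \overline{V e^{σX}}(c))` AT A CURVED SMALL-FIELD BACKGROUND
# (`BlockAverageVaryDisc`)

Cell `pub-balaban`, NE3 formalisation swarm (`t4/formal/NE3/LEAVES.md` row S5∕S6, sub-row S6-Y7; unit
`b2b-balaban-t4-ne3-formalise-leaf-10`, gen 2); sequel of `BlockAverageVaryHolo` (the complex perturbation `cvary`, the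
relative unit `relUnit` and coordinate `relAvg`, their holomorphy, and the motion bounds `norm_Wcx_cvary_sub_le`).
THIS FILE: if `V` is `U(N)`-valued with `SmallField V a`, `512(d+1)(d+4)L²a ≤ 1` (so every loop variable of (42) is
within `1∕32` of `1`, tree `B7Prop2Explicit.norm_Wcx_sub_one_le`) and `‖X(b)‖ ≤ s` on the bonds within `l¹`-distance
`nbRad d L` of `c₋ = q`, then for `nbRad·‖σ‖·s ≤ 1∕128` the loop variables of `V e^{σX}` stay within `3∕64` of `1`,
`‖V̄(c)⁻¹·\overline{V e^{σX}}(c) − 1‖ ≤ 1∕4` (`norm_relUnit_sub_one_le`: `‖X_c‖ ≤ 3∕32`, `‖X_c[V]‖ ≤ 1∕16`,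
`V̄ = e^{X_c}V(Γ_c)`, `V̄(c)` unitary — elementary numerics `e^x − 1 ≤ x + x²`) and `‖relAvg σ‖ ≤ 1∕2`
(`norm_relAvg_le_half`, (26)); hence on the disc `‖σ‖ < rho0 d L ∕ s`, `rho0 d L = 1∕(128·nbRad d L) = 1∕(256(d+1)L)`,
`relAvg` is complex-differentiable and bounded by `1∕2` (`differentiableOn_relAvg`, `norm_relAvg_le_of_mem_ball`) — the two
inputs of the tree's Schwarz-type Taylor toolkit (`NE9Lemma1RemainderPiece.norm_taylorRem_le`), applied in
`BlockAverageQuadRemainder`.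

HONEST FRAMING: finite-`T⁴` kinematics of ONE block-averaging step on ONE lattice (rung (B)+1 — NOT infinite volume, NOT
a mass gap, NOT Clay); no two lattice spacings are compared; nothing of NE3 is claimed (NE3-E stays CONDITIONAL on the
co-owners' ⟨named structures⟩); no `BetaPertH`, no (B), no G-an2-4; no printed sentence is a hypothesis ([cite:] tags
are context).  PLACEMENT (human rule 2026-08-19): our work, under `Summits/QuantumFields/BalabanUV/`.
-/

set_option autoImplicit false

open scoped BigOperators Matrix.Norms.L2Operator Topology
open NormedSpace Finset Filter Metric

namespace Summit.QuantumFields.BalabanUV.T4Continuum.BlockAverageVaryDisc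

open Literature.MathematicalPhysics.QuantumFieldTheory.Balaban1983to89
open B7Prop1Explicit B7Prop2Explicit MatrixLog UnitaryModel
open T4AveragingDeficitWall hiding Site Plane Plaq Bond
open AveragingDeficitSideDeriv (norm_Xavg_le)
open BlockAverageVaryHolo

noncomputable section

variable {d : ℕ} {n : Type*} [Fintype n] [DecidableEq n] [Nonempty n]

/-! ## §1 The regime `nbRad·‖σ‖·s ≤ 1∕128`: loop variables within `3∕64` of `1`, relative unit within `1∕4` -/

/-- `e^x − 1 ≤ c` as soon as `x + x² ≤ c`, on `[0, 1]` (Mathlib `Real.abs_exp_sub_one_sub_id_le`). [folklore] -/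
theorem exp_sub_one_le_of_sq_le {x c : ℝ} (h0 : 0 ≤ x) (h1 : x ≤ 1) (hc : x + x ^ 2 ≤ c) : Real.exp x - 1 ≤ c := by
  have h := Real.abs_exp_sub_one_sub_id_le (x := x) (by rwa [abs_of_nonneg h0])
  have h2 : Real.exp x - 1 - x ≤ x ^ 2 := (le_abs_self _).trans h
  linarith

/-- **THE DISC OF CONTROL.**  For a `U(N)`-valued background in the small-field class `SmallField V a`,
`512(d+1)(d+4)L²a ≤ 1`, a direction with `‖X(b)‖ ≤ s` on the `nbRad`-ball about `c₋ = q`, and a complex parameter with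
`nbRad·‖σ‖·s ≤ 1∕128`: every loop variable of `V e^{σX}` at `c` is within `3∕64` of `1`, and
`‖V̄(c)⁻¹·\overline{V e^{σX}}(c) − 1‖ ≤ 1∕4` (unperturbed loop variables within `1∕32` of `1` by
`B7Prop2Explicit.norm_Wcx_sub_one_le`; transport moves by `≤ e^{1∕128} − 1`; `‖X_c[V e^{σX}]‖ ≤ 3∕32`, `‖X_c[V]‖ ≤ 1∕16`;
`V̄ = e^{X_c}V(Γ_c)`; `V̄(c)` is unitary). [folklore] -/
theorem norm_relUnit_sub_one_le {L : ℕ} (hL : 1 ≤ L) {V : Site d → Fin d → (Matrix n n ℂ)ˣ} (hV : IsUnitaryCfg V)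
    {a : ℝ} (ha : 0 ≤ a) (hsmall : 512 * (d + 1) * (d + 4) * (L : ℝ) ^ 2 * a ≤ 1) (hVa : SmallField V a)
    {X : Site d → Fin d → Matrix n n ℂ} {q : Site d} {s : ℝ}
    (hX : ∀ (x : Site d) (μ : Fin d), l1 (x - q) ≤ nbRad d L → ‖X x μ‖ ≤ s) (κ : Fin d) {σ : ℂ}
    (hσ : (nbRad d L : ℝ) * (‖σ‖ * s) ≤ 1 / 128) :
    (∀ r : Fin d → Fin L,
        ‖((Wcx L (cvary V X σ) q κ (boxVec L r) : (Matrix n n ℂ)ˣ) : Matrix n n ℂ) - 1‖ ≤ 3 / 64) ∧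
      ‖relUnit L V X q κ σ - 1‖ ≤ 1 / 4 := by
  letI : CStarAlgebra (Matrix n n ℂ) := {}
  have hU := U1_of_isUnitaryCfg hV
  -- the unperturbed loop variables
  have hW0 : ∀ r : Fin d → Fin L, ‖((Wcx L V q κ (boxVec L r) : (Matrix n n ℂ)ˣ) : Matrix n n ℂ) - 1‖ ≤ 1 / 32 := by
    intro r
    have h := norm_Wcx_sub_one_le L hL V hU ha hsmall hVa q κ r
    have h0 : 0 ≤ ((d : ℝ) + 1) * ((d : ℝ) + 4) * (L : ℝ) ^ 2 * a := by positivity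
    nlinarith
  -- the size of the move
  have hs : 0 ≤ s := (norm_nonneg _).trans (hX q κ (by rw [l1_sub_self]; exact Nat.zero_le _))
  have hρ : 0 ≤ (nbRad d L : ℝ) * (‖σ‖ * s) := by positivity
  have hE : Real.exp ((nbRad d L : ℝ) * (‖σ‖ * s)) - 1 ≤ 129 / 16384 :=
    exp_sub_one_le_of_sq_le hρ (hσ.trans (by norm_num)) (by nlinarith)
  obtain ⟨hW1, hseg1, hseg2⟩ := norm_Wcx_cvary_sub_le hU hX σ κ
  -- the perturbed loop variables
  have hWσ : ∀ r : Fin d → Fin L,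
      ‖((Wcx L (cvary V X σ) q κ (boxVec L r) : (Matrix n n ℂ)ˣ) : Matrix n n ℂ) - 1‖ ≤ 3 / 64 := by
    intro r
    calc _ = ‖(((Wcx L (cvary V X σ) q κ (boxVec L r) : (Matrix n n ℂ)ˣ) : Matrix n n ℂ)
              - ((Wcx L V q κ (boxVec L r) : (Matrix n n ℂ)ˣ) : Matrix n n ℂ))
            + (((Wcx L V q κ (boxVec L r) : (Matrix n n ℂ)ˣ) : Matrix n n ℂ) - 1)‖ := by
          congr 1; abel
      _ ≤ _ := norm_add_le _ _
      _ ≤ (129 / 16384) + 1 / 32 := add_le_add ((hW1 r).trans hE) (hW0 r)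
      _ ≤ 3 / 64 := by norm_num
  refine ⟨hWσ, ?_⟩
  -- the exponents of (42)
  have hXσ : ‖Xavg L (cvary V X σ) q κ‖ ≤ 2 * (3 / 64) := norm_Xavg_le L hL _ q κ (by norm_num) hWσ
  have hX0 : ‖Xavg L V q κ‖ ≤ 2 * (1 / 32) := norm_Xavg_le L hL _ q κ (by norm_num) hW0
  obtain ⟨heσ, -⟩ := norm_exp_le_of_norm_le hXσ
  obtain ⟨he0, -⟩ := norm_exp_le_of_norm_le hX0
  have h1 : Real.exp (2 * (3 / 64) : ℝ) - 1 ≤ 105 / 1024 :=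
    exp_sub_one_le_of_sq_le (by norm_num) (by norm_num) (by norm_num)
  have h2 : Real.exp (2 * (1 / 32) : ℝ) - 1 ≤ 17 / 256 :=
    exp_sub_one_le_of_sq_le (by norm_num) (by norm_num) (by norm_num)
  -- the averages as matrices
  set Eσ := exp (Xavg L (cvary V X σ) q κ) with hEσ
  set E0 := exp (Xavg L V q κ) with hE0
  set Hσ := ((hol (cvary V X σ) q (seg κ L) : (Matrix n n ℂ)ˣ) : Matrix n n ℂ) with hHσ
  set H0 := ((hol V q (seg κ L) : (Matrix n n ℂ)ˣ) : Matrix n n ℂ) with hH0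
  have hH0n : ‖H0‖ ≤ 1 := (hol_mem hU q (seg κ L)).1
  have hHσn : ‖Hσ‖ ≤ 1 + 129 / 16384 := hseg2.trans (by linarith)
  have ha1 : ‖Eσ - 1‖ ≤ 105 / 1024 := heσ.trans h1
  have ha2 : ‖E0 - 1‖ ≤ 17 / 256 := he0.trans h2
  have ha3 : ‖Hσ - H0‖ ≤ 129 / 16384 := hseg1.trans hE
  have hBdiff : ‖Eσ * Hσ - E0 * H0‖ ≤ 3 / 16 := by
    have hsplit : Eσ * Hσ - E0 * H0 = (Eσ - 1) * Hσ + (Hσ - H0) - (E0 - 1) * H0 := by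
      simp only [sub_mul, one_mul]; abel
    rw [hsplit]
    calc ‖(Eσ - 1) * Hσ + (Hσ - H0) - (E0 - 1) * H0‖
          ≤ ‖(Eσ - 1) * Hσ + (Hσ - H0)‖ + ‖(E0 - 1) * H0‖ := norm_sub_le _ _
      _ ≤ ‖(Eσ - 1) * Hσ‖ + ‖Hσ - H0‖ + ‖(E0 - 1) * H0‖ := add_le_add (norm_add_le _ _) le_rfl
      _ ≤ ‖Eσ - 1‖ * ‖Hσ‖ + ‖Hσ - H0‖ + ‖E0 - 1‖ * ‖H0‖ :=
          add_le_add (add_le_add (norm_mul_le _ _) le_rfl) (norm_mul_le _ _)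
      _ ≤ (105 / 1024) * (1 + 129 / 16384) + 129 / 16384 + (17 / 256) * 1 := by
          gcongr
      _ ≤ 3 / 16 := by norm_num
  -- `V̄(c)` is unitary, so `‖V̄(c)⁻¹‖ ≤ 1`
  have hbU : bavg L V q κ ∈ unitaryUnits (Matrix n n ℂ) :=
    bavg_mem_unitaryUnits (V := V) hV L q κ fun r => (hW0 r).trans (by norm_num)
  have hbinv : ‖(((bavg L V q κ)⁻¹ : (Matrix n n ℂ)ˣ) : Matrix n n ℂ)‖ ≤ 1 :=
    (CStarRing.norm_of_mem_unitary ((unitaryUnits (Matrix n n ℂ)).inv_mem hbU)).le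
  have hrel : relUnit L V X q κ σ - 1
      = (((bavg L V q κ)⁻¹ : (Matrix n n ℂ)ˣ) : Matrix n n ℂ) * (Eσ * Hσ - E0 * H0) := by
    have h1 : (((bavg L V q κ)⁻¹ : (Matrix n n ℂ)ˣ) : Matrix n n ℂ) * (E0 * H0) = 1 := by
      rw [hE0, hH0, ← val_bavg, ← Units.val_mul, inv_mul_cancel, Units.val_one]
    rw [relUnit, mul_sub, h1, val_bavg]
  rw [hrel]
  calc _ ≤ ‖(((bavg L V q κ)⁻¹ : (Matrix n n ℂ)ˣ) : Matrix n n ℂ)‖ * ‖Eσ * Hσ - E0 * H0‖ := norm_mul_le _ _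
    _ ≤ 1 * (3 / 16) := mul_le_mul hbinv hBdiff (norm_nonneg _) zero_le_one
    _ ≤ 1 / 4 := by norm_num

/-- … hence `‖relAvg σ‖ ≤ 1∕2` in the same regime ((26): `|log W| ≤ 2|W − 1|`). [folklore] -/
theorem norm_relAvg_le_half {L : ℕ} (hL : 1 ≤ L) {V : Site d → Fin d → (Matrix n n ℂ)ˣ} (hV : IsUnitaryCfg V)
    {a : ℝ} (ha : 0 ≤ a) (hsmall : 512 * (d + 1) * (d + 4) * (L : ℝ) ^ 2 * a ≤ 1) (hVa : SmallField V a)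
    {X : Site d → Fin d → Matrix n n ℂ} {q : Site d} {s : ℝ}
    (hX : ∀ (x : Site d) (μ : Fin d), l1 (x - q) ≤ nbRad d L → ‖X x μ‖ ≤ s) (κ : Fin d) {σ : ℂ}
    (hσ : (nbRad d L : ℝ) * (‖σ‖ * s) ≤ 1 / 128) :
    ‖relAvg L V X q κ σ‖ ≤ 1 / 2 := by
  have h := (norm_relUnit_sub_one_le hL hV ha hsmall hVa hX κ hσ).2
  have h2 := norm_mlog_le_two_mul (h.trans (by norm_num))
  unfold relAvg
  linarith

/-! ## §2 The disc `‖σ‖ < rho0 ∕ s`: holomorphy and the bound `1∕2` -/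

/-- THE CONTROL RADIUS in units of `1∕s`: `rho0 d L = 1∕(128·nbRad d L) = 1∕(256(d+1)L)`. [folklore] -/
def rho0 (d L : ℕ) : ℝ := 1 / (128 * (nbRad d L : ℝ))

/-- `nbRad ≥ 2` for `L ≥ 1`. [folklore] -/
theorem two_le_nbRad {L : ℕ} (hL : 1 ≤ L) : 2 ≤ nbRad d L := by
  unfold nbRad; omega

/-- `rho0 > 0`. [folklore] -/
theorem rho0_pos {L : ℕ} (hL : 1 ≤ L) : 0 < rho0 d L := by
  have : (2 : ℝ) ≤ nbRad d L := by exact_mod_cast two_le_nbRad hL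
  unfold rho0; positivity

/-- Inside the disc `‖σ‖ < rho0∕s` the regime `nbRad·‖σ‖s ≤ 1∕128` holds. [folklore] -/
theorem regime_of_mem_ball {L : ℕ} (hL : 1 ≤ L) {s : ℝ} (hs : 0 < s) {σ : ℂ}
    (hσ : σ ∈ ball (0 : ℂ) (rho0 d L / s)) : (nbRad d L : ℝ) * (‖σ‖ * s) ≤ 1 / 128 := by
  rw [mem_ball_zero_iff] at hσ
  have hN : (2 : ℝ) ≤ nbRad d L := by exact_mod_cast two_le_nbRad hL
  have hN0 : (0 : ℝ) < nbRad d L := by linarith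
  have h1 : ‖σ‖ * s ≤ rho0 d L := ((lt_div_iff₀ hs).1 hσ).le
  calc (nbRad d L : ℝ) * (‖σ‖ * s) ≤ (nbRad d L : ℝ) * rho0 d L := mul_le_mul_of_nonneg_left h1 hN0.le
    _ = 1 / 128 := by unfold rho0; field_simp

/-- **HOLOMORPHY ON THE DISC**: under the hypotheses of `norm_relUnit_sub_one_le` with `s > 0`, the relative chart
coordinate `σ ↦ log(V̄(c)⁻¹·\overline{V e^{σX}}(c))` is complex-differentiable on `‖σ‖ < rho0 d L ∕ s`. [folklore] -/
theorem differentiableOn_relAvg {L : ℕ} (hL : 1 ≤ L) {V : Site d → Fin d → (Matrix n n ℂ)ˣ} (hV : IsUnitaryCfg V)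
    {a : ℝ} (ha : 0 ≤ a) (hsmall : 512 * (d + 1) * (d + 4) * (L : ℝ) ^ 2 * a ≤ 1) (hVa : SmallField V a)
    {X : Site d → Fin d → Matrix n n ℂ} {q : Site d} {s : ℝ} (hs : 0 < s)
    (hX : ∀ (x : Site d) (μ : Fin d), l1 (x - q) ≤ nbRad d L → ‖X x μ‖ ≤ s) (κ : Fin d) :
    DifferentiableOn ℂ (relAvg L V X q κ) (ball (0 : ℂ) (rho0 d L / s)) := by
  intro σ hσ
  obtain ⟨hW, hY⟩ := norm_relUnit_sub_one_le hL hV ha hsmall hVa hX κ (regime_of_mem_ball hL hs hσ)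
  exact (analyticAt_relAvg V X σ L q κ (fun r => (hW r).trans_lt (by norm_num))
    (hY.trans_lt (by norm_num))).differentiableAt.differentiableWithinAt

/-- **THE BOUND ON THE DISC**: `‖relAvg σ‖ ≤ 1∕2` for `‖σ‖ < rho0 d L ∕ s`. [folklore] -/
theorem norm_relAvg_le_of_mem_ball {L : ℕ} (hL : 1 ≤ L) {V : Site d → Fin d → (Matrix n n ℂ)ˣ} (hV : IsUnitaryCfg V)
    {a : ℝ} (ha : 0 ≤ a) (hsmall : 512 * (d + 1) * (d + 4) * (L : ℝ) ^ 2 * a ≤ 1) (hVa : SmallField V a)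
    {X : Site d → Fin d → Matrix n n ℂ} {q : Site d} {s : ℝ} (hs : 0 < s)
    (hX : ∀ (x : Site d) (μ : Fin d), l1 (x - q) ≤ nbRad d L → ‖X x μ‖ ≤ s) (κ : Fin d) :
    ∀ σ ∈ ball (0 : ℂ) (rho0 d L / s), ‖relAvg L V X q κ σ‖ ≤ 1 / 2 := fun _ hσ =>
  norm_relAvg_le_half hL hV ha hsmall hVa hX κ (regime_of_mem_ball hL hs hσ)

end

end Summit.QuantumFields.BalabanUV.T4Continuum.BlockAverageVaryDisc
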